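import Mathlib
import Literature.AlgebraicGeometry.Resolution.PointChartPresentation
import Literature.AlgebraicGeometry.Resolution.CutkoskySurfaceOmegaSequence
import HarnessLib

/-!
# Cutkosky 2009, Lemmas 10.13–10.15 (last clauses): a curve of `Sing_r` inside the exceptional divisor through the new point is `V(x₁, z₁)` (PROVED)

Topic: `Literature/AlgebraicGeometry/Resolution`.  S. D. Cutkosky, *Resolution of singularities for
3-folds in positive characteristic*, Amer. J. Math. **131** (2009) 59–127 [cite: Cutkosky2009],
Lemma 10.13 (p. 32 l. 31–33, proof p. 32 l. 40 – p. 33 l. 12: "Since `Sing_r(I) = V(x, z)`, we have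
`Sing_r(I₁) ⊂ V(x₁)` … Suppose that `Sing_r(I₁)` is a nonsingular curve `C` … We conclude that
`Sing_r(I₁) ⊂ V(x₁, z₁)`"), Lemma 10.14 (p. 33 l. 58, l. 69–72: "By Lemmas 5.1 and 10.1,
`Sing_r(I₁) ⊂ V(x₁, z₁)`") and Lemma 10.15 (p. 33 l. 77, p. 34 l. 12–13).

This file proves the ALGEBRAIC HALF of these clauses, in a general local frame: once a curve germ
`V(P)` of `Sing_r(I₁)` through the new point is known to lie in the exceptional divisor (`x₁ ∈ P` —
in the paper this is Lemma 5.1 (1) / semicontinuity of the order; it is an INPUT here), the monic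
element `a z₁^r + x₁ h ∈ I₁` (the weak transform of an element `≡ a z^r (mod 𝔪^{r+1})` of `I`, `a` a
unit, in a Tr1/Tr3 chart `z = x₁ z₁`) forces `z₁ ∈ P`, and a regular curve germ containing the
regular pair `(x₁, z₁)` IS `(x₁, z₁)`.

## What is PROVED (theorems only; no definition, no fact)

* `mem_of_monic_of_inSingR` — `P` prime, `x₁ ∈ P`, `a z₁^r + x₁ h` thrown into `P^r` by an element
  outside `P` (`r ≥ 1`, `a` a unit) ⇒ `z₁ ∈ P`;
* `span_pair_eq_of_le` — in a regular local ring of dimension `3`, if `(x₁, z₁)` (part of a regular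
  system `(z₁, x₁, y₁)`) is contained in `(v 0, v 1)` (part of a regular system `v`) then
  `(v 0, v 1) = (x₁, z₁)` (Cramer modulo `𝔪²`, via `mem_maximalIdeal_of_lin_mem_sq`);
* `exists_monic_mem_colon` — the weak transform of a monic element in a chart with `φ(z) = φ(x)·z₁`,
  `φ(𝔪) ⊆ (φ x)`: `φ(a) z₁^μ + φ(x) h ∈ (J R' : φ(x)^μ)`;
* `curve_eq_span_pair_of_inSingR` — the combination in the vocabulary of
  `CutkoskySurfaceOmegaSequence.lean` (`InSingR`, `IsRegularCurveGerm`, `IsParams`): a regular curve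
  germ `P` of `Sing_r(I₁)` with `x₁ ∈ P`, for `I₁ ∋ a z₁^r + x₁ h`, is `(x₁, z₁)`.

AI-written; weaker than expert review.

## Sources

* S. D. Cutkosky, Amer. J. Math. 131 (2009), Lemma 10.13 and proof p. 32 l. 31 – p. 33 l. 12;
  Lemma 10.14 p. 33 l. 58, 69–72; Lemma 10.15 p. 33 l. 77, p. 34 l. 12–13. [Cutkosky2009]
-/

noncomputable section

open IsLocalRing

namespace Literature.AlgebraicGeometry.Resolution.Cutkosky2009

universe u

section General

variable {R : Type u} [CommRing R]

/-- **The monic element forces `z₁ ∈ P`.**  If `P` is prime, `x₁ ∈ P`, `a` is a unit, `r ≥ 1` and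
`s (a z₁^r + x₁ h) ∈ P^r` for some `s ∉ P`, then `z₁ ∈ P`.
[cite: Cutkosky2009, proof of Lemma 10.13, p. 32 l. 44 – p. 33 l. 12] -/
theorem mem_of_monic_of_inSingR {P : Ideal R} (hP : P.IsPrime) {x₁ z₁ a h s : R} {r : ℕ}
    (hr : 1 ≤ r) (hx₁ : x₁ ∈ P) (ha : IsUnit a) (hs : s ∉ P)
    (hmem : s * (a * z₁ ^ r + x₁ * h) ∈ P ^ r) : z₁ ∈ P := by
  have h1 : s * (a * z₁ ^ r + x₁ * h) ∈ P := Ideal.pow_le_self (by omega) hmem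
  have h2 : s * (a * z₁ ^ r) ∈ P := by
    have : s * (a * z₁ ^ r) = s * (a * z₁ ^ r + x₁ * h) - s * h * x₁ := by ring
    rw [this]
    exact Ideal.sub_mem _ h1 (Ideal.mul_mem_left _ _ hx₁)
  rcases hP.mem_or_mem h2 with h3 | h3
  · exact absurd h3 hs
  rcases hP.mem_or_mem h3 with h4 | h4
  · exact absurd (Ideal.eq_top_of_isUnit_mem _ h4 ha) hP.ne_top
  · exact hP.mem_of_pow_mem r h4

variable [IsRegularLocalRing R]

/-- **A regular curve germ containing a regular pair is that pair.**  In a regular local ring of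
dimension `3`: if `(z₁, x₁, y₁)` and `v` are regular systems of parameters and
`x₁, z₁ ∈ (v 0, v 1)`, then `(v 0, v 1) = (x₁, z₁)`.
[cite: Cutkosky2009, proof of Lemma 10.13, p. 33 l. 10–12] -/
theorem span_pair_eq_of_le {c' v : Fin 3 → R}
    (hgen' : Ideal.span {c' 0, c' 1, c' 2} = maximalIdeal R) (hdim : ringKrullDim R = 3)
    (hv : Ideal.span {v 0, v 1, v 2} = maximalIdeal R)
    (hle : Ideal.span {c' 1, c' 0} ≤ Ideal.span {v 0, v 1}) :
    Ideal.span {v 0, v 1} = Ideal.span {c' 1, c' 0} := by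
  classical
  have hvi : ∀ i, v i ∈ maximalIdeal R := fun i => by
    rw [← hv]; exact Ideal.subset_span (by fin_cases i <;> simp)
  have hx : c' 1 ∈ Ideal.span ({v 0, v 1} : Set R) := hle (Ideal.subset_span (by simp))
  have hz : c' 0 ∈ Ideal.span ({v 0, v 1} : Set R) := hle (Ideal.subset_span (by simp))
  obtain ⟨a, b, hab⟩ := Ideal.mem_span_pair.mp hx
  obtain ⟨c, d, hcd⟩ := Ideal.mem_span_pair.mp hz
  -- Cramer identities
  have e0 : (a * d - b * c) * v 0 = d * c' 1 - b * c' 0 := by rw [← hab, ← hcd]; ring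
  have e1 : (a * d - b * c) * v 1 = a * c' 0 - c * c' 1 := by rw [← hab, ← hcd]; ring
  -- the determinant is a unit
  have hdet : IsUnit (a * d - b * c) := by
    by_contra hnu
    have hdet𝔪 : a * d - b * c ∈ maximalIdeal R := (mem_maximalIdeal _).mpr hnu
    have hsq0 : d * c' 1 - b * c' 0 ∈ maximalIdeal R ^ 2 := by
      rw [← e0, pow_two]; exact Ideal.mul_mem_mul hdet𝔪 (hvi 0)
    have hsq1 : a * c' 0 - c * c' 1 ∈ maximalIdeal R ^ 2 := by
      rw [← e1, pow_two]; exact Ideal.mul_mem_mul hdet𝔪 (hvi 1)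
    have hb : b ∈ maximalIdeal R := by
      have := mem_maximalIdeal_of_lin_mem_sq c' hgen' hdim ![-b, d, 0]
        (by simpa [sub_eq_add_neg, add_comm] using hsq0) 0
      simpa using this
    have ha : a ∈ maximalIdeal R := by
      have := mem_maximalIdeal_of_lin_mem_sq c' hgen' hdim ![a, -c, 0]
        (by simpa [sub_eq_add_neg] using hsq1) 0
      simpa using this
    -- then `x₁ ∈ 𝔪²`, contradicting independence
    have hx2 : c' 1 ∈ maximalIdeal R ^ 2 := by
      rw [← hab, pow_two]
      exact Ideal.add_mem _ (Ideal.mul_mem_mul ha (hvi 0)) (Ideal.mul_mem_mul hb (hvi 1))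
    have := mem_maximalIdeal_of_lin_mem_sq c' hgen' hdim ![0, 1, 0] (by simpa using hx2) 1
    simp at this
  obtain ⟨δ, hδ⟩ := hdet.exists_left_inv
  apply le_antisymm
  · rw [Ideal.span_le]
    rintro w hw
    simp only [Set.mem_insert_iff, Set.mem_singleton_iff] at hw
    have hx' : c' 1 ∈ Ideal.span ({c' 1, c' 0} : Set R) := Ideal.subset_span (by simp)
    have hz' : c' 0 ∈ Ideal.span ({c' 1, c' 0} : Set R) := Ideal.subset_span (by simp)
    rcases hw with rfl | rfl
    · have : v 0 = δ * (d * c' 1 - b * c' 0) := by rw [← e0]; linear_combination (-(v 0)) * hδ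
      rw [this]
      exact Ideal.mul_mem_left _ _ (Ideal.sub_mem _ (Ideal.mul_mem_left _ _ hx')
        (Ideal.mul_mem_left _ _ hz'))
    · have : v 1 = δ * (a * c' 0 - c * c' 1) := by rw [← e1]; linear_combination (-(v 1)) * hδ
      rw [this]
      exact Ideal.mul_mem_left _ _ (Ideal.sub_mem _ (Ideal.mul_mem_left _ _ hz')
        (Ideal.mul_mem_left _ _ hx'))
  · exact hle

end General

section Chart

variable {R R' : Type u} [CommRing R] [CommRing R'] [IsLocalRing R] (φ : R →+* R')
  {c : Fin 3 → R} {c' : Fin 3 → R'}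

/-- **The weak transform of a monic element** in a chart with exceptional parameter `φ(x)`
(`x = c 1`) and `φ(z) = φ(x) · z₁` (`z = c 0`, `z₁ = c' 0`), `φ(𝔪) ⊆ (φ x)`: if `g ∈ J` and
`g ≡ a z^μ (mod 𝔪^{μ+1})` then `φ(a) z₁^μ + φ(x) h ∈ (J R' : φ(x)^μ)` for some `h`.
[cite: Cutkosky2009, proof of Lemma 10.13, p. 32 l. 48–52] -/
theorem exists_monic_mem_colon (h₀ : φ (c 0) = φ (c 1) * c' 0) (hmap𝔪 : (maximalIdeal R).map φ ≤ Ideal.span {φ (c 1)})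
    {J : Ideal R} {μ : ℕ} {g a : R} (hg : g ∈ J)
    (hrem : g - a * c 0 ^ μ ∈ maximalIdeal R ^ (μ + 1)) :
    ∃ h : R', φ a * c' 0 ^ μ + φ (c 1) * h ∈ (J.map φ).colon (Ideal.span {φ (c 1) ^ μ}) := by
  classical
  have hpow : (maximalIdeal R ^ (μ + 1)).map φ ≤ Ideal.span {φ (c 1) ^ (μ + 1)} := by
    rw [Ideal.map_pow, ← Ideal.span_singleton_pow]; exact Ideal.pow_right_mono hmap𝔪 _
  obtain ⟨w, hw⟩ := Ideal.mem_span_singleton'.mp (hpow (Ideal.mem_map_of_mem φ hrem))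
  refine ⟨w, ?_⟩
  rw [Submodule.mem_colon_span_singleton, smul_eq_mul]
  have : (φ a * c' 0 ^ μ + φ (c 1) * w) * φ (c 1) ^ μ = φ g := by
    have e : φ g = φ (a * c 0 ^ μ) + φ (g - a * c 0 ^ μ) := by rw [← map_add]; ring_nf
    rw [e, map_mul, map_pow, h₀, ← hw]; ring
  rw [this]; exact Ideal.mem_map_of_mem φ hg

end Chart

section Germ

variable {R : Type u} [CommRing R] [IsRegularLocalRing R]

/-- **Cutkosky 2009, Lemmas 10.13 / 10.14 / 10.15 (last clauses), algebraic half, PROVED**: in a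
regular local ring of dimension `3` with regular parameters `c' = (z₁, x₁, y₁)`, a nonsingular curve
germ `P` of `Sing_r(I₁)` (`InSingR I₁ r P`, `IsRegularCurveGerm P`) lying in the exceptional divisor
(`x₁ ∈ P`) is `V(x₁, z₁)`, as soon as `I₁` contains a monic element `a z₁^r + x₁ h` (`a` a unit,
`r ≥ 1`). [cite: Cutkosky2009, Lemma 10.13 p. 32 l. 31–33; Lemma 10.14 p. 33 l. 58] -/
theorem curve_eq_span_pair_of_inSingR {c' : Fin 3 → R}
    (hgen' : Ideal.span {c' 0, c' 1, c' 2} = maximalIdeal R) (hdim : ringKrullDim R = 3)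
    {I₁ P : Ideal R} {r : ℕ} (hr : 1 ≤ r) (hsing : InSingR I₁ r P) (hcurve : IsRegularCurveGerm P)
    (hx₁ : c' 1 ∈ P) {a h : R} (ha : IsUnit a) (hmonic : a * c' 0 ^ r + c' 1 * h ∈ I₁) :
    P = Ideal.span {c' 1, c' 0} := by
  obtain ⟨hP, hthrow⟩ := hsing
  obtain ⟨s, hs, hsmem⟩ := hthrow _ hmonic
  have hz₁ : c' 0 ∈ P := mem_of_monic_of_inSingR hP hr hx₁ ha hs hsmem
  obtain ⟨v, hv, rfl⟩ := hcurve
  refine span_pair_eq_of_le hgen' hdim hv ?_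
  rw [Ideal.span_le]
  rintro w hw
  simp only [Set.mem_insert_iff, Set.mem_singleton_iff] at hw
  rcases hw with rfl | rfl
  · exact hx₁
  · exact hz₁

end Germ

end Literature.AlgebraicGeometry.Resolution.Cutkosky2009
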